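import Summits.CriticalPhenomena.PercolationContinuityZ3.Theorems.PercNearOneGluingNoHeavyLowerTailTerminalEdgeStepLeFive
import Mathlib.Logic.Equiv.Fintype
import HarnessLib

/-!
# `NoHeavyLowerTail` (crux stmt-CriticalPhenomena-4575): the p-FREE form of the terminal-edge step rows — THREE-COPY COMB POSITIVITY as a
# named statement, its soundness, the proved rungs `n = 4, 5`, the transport to every quadruple for EVERY `n`, and the all-`n` conjecture

Support file (prover seat `prim-bnk-1`, bounded-n kernel theorems; `--supports stmt-CriticalPhenomena-4575`).  Three small definitions
(`E3GroupSepCert.CombPositive`, `TerminalEdgeStep.CombStep`, `TerminalEdgeStep.CombStepConjecture`), no named facts, no sorries, no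
`native_decide` in this file (the rungs `n = 4, 5` reuse `TerminalEdgeStep.checkStep4/5`, p197144, which are `native_decide` evaluations).

WHY.  Every seat working on the polarised rows (L1),(L2) of the SHK3⁺ terminal-edge step now refers to "COMB(L1)", the p-free statement that
ALL `4^m` tensor-Bernstein coefficients (three-copy fibre sums) of the row polynomial on `K_n` are `≥ 0` (prim-l12-p2 MEMO-P2-DC §6: "COMB(L1)
conjecture is the p-free form"; prim-l12-p6 edge-Bernstein conjecture, ttrl l.538; prim-bnk-2 K7-REDUCTION.md; prim-lit-2's switching
certificates, which are fibre-preserving and therefore PROVE comb positivity of whatever they certify).  The bounded-n ladder certifies exactly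
this statement: `n ≤ 5` in the kernel (p197144), `n = 6` by two independent exact engines (prim-bnk-2 j075722 comb3s = prim-bnk-1 j077085
fib3t: 0 negative fibres of 4^15 for L1, L2, B1, B2), `n = 7` = prim-bnk-2's campaign.  This file TYPES it:

* `E3GroupSepCert.CombPositive ts` — all three-copy fibre sums `cubicCoef` of the signed cubic term list `ts` on `K_n` are `≥ 0`;
  `cval_eq_cubicForm`, **`cval_nonneg_of_combPositive`** (soundness: the cubic form is `≥ 0` at every weight vector — `CovTransferCert.cubicForm_nonneg`),
  **`combPositive_of_checkC`** (the Kronecker-digit checker `checkC` of prim-cert-2 certifies `CombPositive`; this is the first half of `checkC_sound`);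
* `E3GroupSepCert.cover_quad` — for EVERY `n ≥ 4`, every pairwise-distinct quadruple of `Fin n` is a vertex relabelling of the standard one
  (`Equiv.Perm.exists_extending_pair`; replaces the `native_decide` covers `cover_quad4/5` for general `n`), whence
  `TerminalEdgeStep.qRowHolds_of_quad₀`: a row at all weights at the standard quadruple gives it at all weights at every distinct quadruple;
* `TerminalEdgeStep.CombStep n h` — the four step rows (L1),(L2),(B1),(B2) are comb positive on `K_n` at the standard quadruple;
  **`combStep_four`, `combStep_five`** (PROVED, from `checkStep4/5`); **`qRowHolds_of_combStep`**: `CombStep n ⇒` the four rows at every weight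
  vector and every distinct quadruple of `Fin n`; `polarisedStep_of_combStep` in the `PolarisedStepUpTo`/`BernsteinStepUpTo` vocabulary;
* `TerminalEdgeStep.CombStepConjecture := ∀ n ≥ 4, CombStep n` — the p-free all-`n` target — and **`stepUpTo_of_combStepConjecture`**:
  it implies `PolarisedStepUpTo N ∧ BernsteinStepUpTo N` for every `N`, i.e. (L1),(L2),(B1),(B2) on every finite weighted graph.
STATUS of the instances: `CombStep 4`, `CombStep 5` theorems (here); `CombStep 6 (by norm_num)` CERTIFIED OUTSIDE LEAN by two independent
exact implementations (above; not a Lean theorem — 4^15 fibres exceed the in-kernel checker); `CombStep 7 _` = prim-bnk-2's running campaign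
((A) digits {0,1,2} by comb3x + (B),(C) K6 faces, K7-REDUCTION.md); `CombStepConjecture` OPEN (0 negative fibres also on 159 sparse supports
with n ≤ 8, j077088, and coefficientwise censuses of prim-l12-p2 j076212).
-/

namespace Summit.CriticalPhenomena.PercolationContinuityZ3.Theorems

namespace E3GroupSepCert

open Finset MeasureTheory OneCutCert CovTransferCert
open scoped BigOperators
open Literature.Probability.Percolation Literature.Probability.LatticeModels

variable {n : ℕ}

/-! ## Comb positivity of a signed cubic term list -/

/-- The sign vector of a term list. [this work] -/
def sgnOf (ts : List (CTerm n)) : Fin ts.length → ℤ := fun j => (ts[(j : ℕ)]).1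
/-- The first event tables of a term list. [this work] -/
def tabX (ts : List (CTerm n)) : Fin ts.length → (Fin (mE n) → Bool) → ℤ := fun j => tabT n (ts[(j : ℕ)]).2.1
/-- The second event tables of a term list. [this work] -/
def tabY (ts : List (CTerm n)) : Fin ts.length → (Fin (mE n) → Bool) → ℤ := fun j => tabT n (ts[(j : ℕ)]).2.2.1
/-- The third event tables of a term list. [this work] -/
def tabZ (ts : List (CTerm n)) : Fin ts.length → (Fin (mE n) → Bool) → ℤ := fun j => tabT n (ts[(j : ℕ)]).2.2.2

/-- **Comb positivity** ("Richards-comb" / tensor-Bernstein positivity) of a signed cubic term list on `K_n`: every three-copy fibre sum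
`Σ_j s_j · #{(ω₁,ω₂,ω₃) in the fibre k : ω₁ ∈ A_j, ω₂ ∈ B_j, ω₃ ∈ C_j}` — the coefficient of `∏_e w_e^{k_e}(1−w_e)^{3−k_e}` in the row
polynomial — is nonnegative.  A p-free (purely combinatorial) statement about 3-colourings of the edges of `K_n`. [this work] -/
def CombPositive (ts : List (CTerm n)) : Prop := ∀ k : Fin (mE n) → Fin 4, 0 ≤ cubicCoef (sgnOf ts) (tabX ts) (tabY ts) (tabZ ts) k

/-- The value of a term list at a weight vector is its cubic form at the point `xOf w` of the cube. [this work] -/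
theorem cval_eq_cubicForm (w : Sym2 (Fin n) → unitInterval) (ts : List (CTerm n)) :
    cval w ts = cubicForm (sgnOf ts) (tabX ts) (tabY ts) (tabZ ts) (xOf w) := by
  unfold cval pr cubicForm
  rw [← sum_fin_eq_sum_map ts]
  refine Finset.sum_congr rfl fun j _ => ?_
  simp only [sgnOf, tabX, tabY, tabZ, real_connEvent_eq_ML]
  ring

/-- **Soundness of comb positivity**: a comb-positive row is nonnegative at EVERY weight vector (all supports, all weights). [this work] -/
theorem cval_nonneg_of_combPositive {ts : List (CTerm n)} (h : CombPositive ts) (w : Sym2 (Fin n) → unitInterval) : 0 ≤ cval w ts := by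
  rw [cval_eq_cubicForm]
  exact cubicForm_nonneg h (inCube_xOf w)

set_option maxHeartbeats 800000 in
/-- **The checker certifies comb positivity**: `checkC n σ ts = true` implies that every fibre sum is `≥ 0` (the digit test on the Kronecker
number; first half of prim-cert-2's `checkC_sound`). [this work] -/
theorem combPositive_of_checkC (σ : ℕ) (ts : List (CTerm n)) (h : checkC n σ ts = true) : CombPositive ts := by
  unfold checkC checkCW at h
  simp only [Bool.and_eq_true, decide_eq_true_eq] at h
  obtain ⟨⟨⟨hσ, hbnd⟩, hZ⟩, hland⟩ := h
  set m := mE n with hm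
  have hoff : offT σ m = (maskN σ (4 ^ m) : ℤ) := by
    unfold offT
    rw [off_eq σ (4 ^ m) hσ, maskN_eq_sum σ hσ, Finset.mul_sum]
  rw [hoff] at hZ hland
  rw [Int.toNat_natCast] at hland
  have hK : ∀ P : CRel n → Bool, (krN4 σ m (evTab n P) : ℤ) = KR4 (2 ^ σ) (tabT n P) := fun P =>
    krN4_eq σ m _ (length_evTab P)
  have hZeq : zC (baseRT n) n σ ts = cubicZ (2 ^ σ) (sgnOf ts) (tabX ts) (tabY ts) (tabZ ts) := by
    unfold zC cubicZ
    dsimp only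
    rw [← sum_fin_eq_sum_map ts]
    refine Finset.sum_congr rfl fun j _ => ?_
    rw [← evTab, ← evTab, ← evTab, hK, hK, hK]
    rfl
  have hB : CoefBound3 (sgnOf ts) (tabX ts) (tabY ts) (tabZ ts) (2 ^ (σ - 1)) := by
    intro k
    have h8 : ∀ j, |sgnOf ts j * pcoef3 (tabX ts j) (tabY ts j) (tabZ ts j) k| ≤ |sgnOf ts j| * 8 ^ m := by
      intro j
      rw [abs_mul]
      exact mul_le_mul_of_nonneg_left (abs_pcoef3_le _ _ _ (abs_tabT_le _) (abs_tabT_le _) (abs_tabT_le _) k) (abs_nonneg _)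
    have hsum : |cubicCoef (sgnOf ts) (tabX ts) (tabY ts) (tabZ ts) k| ≤ (sabs ts : ℤ) * 8 ^ m := by
      unfold cubicCoef
      rw [sabs_eq, Finset.sum_mul]
      exact (Finset.abs_sum_le_sum_abs _ _).trans (Finset.sum_le_sum fun j _ => h8 j)
    have hpow : (sabs ts : ℤ) * 8 ^ m < (2 : ℕ) ^ (σ - 1) := by exact_mod_cast hbnd
    exact lt_of_le_of_lt hsum hpow
  set N : ℕ := (zC (baseRT n) n σ ts + maskN σ (4 ^ m)).toNat with hN
  have hNZ : (N : ℤ) = cubicZ (2 ^ σ) (sgnOf ts) (tabX ts) (tabY ts) (tabZ ts) + ∑ j : Fin (4 ^ m), (2 : ℤ) ^ (σ - 1) * (2 ^ σ) ^ (j : ℕ) := by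
    rw [hN, Int.toNat_of_nonneg hZ, hZeq, maskN_eq_sum σ hσ, Fin.sum_univ_eq_sum_range
      (fun j => (2 : ℤ) ^ (σ - 1) * (2 ^ σ) ^ j) (4 ^ m)]
  have hdig : ∀ j : ℕ, j < 4 ^ m → 2 ^ (σ - 1) ≤ digit (2 ^ σ) N j := digit_ge_of_land σ hσ (4 ^ m) N hland
  exact cubicCoef_nonneg_of_digit_ge hσ hB N hNZ hdig

/-! ## Every distinct quadruple is a relabelling of the standard one (all `n`) -/

/-- **Cover of the distinct quadruples of `Fin n` for every `n ≥ 4`** (via `Equiv.Perm.exists_extending_pair`). [this work] -/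
theorem cover_quad (h : 4 ≤ n) : ∀ t ∈ distinctQuad n, ∃ σ : Equiv.Perm (Fin n), quadmap σ (quad₀ n h) = t := by
  rintro ⟨a, b, c, d⟩ ht
  unfold distinctQuad at ht
  rw [List.mem_filter, decide_eq_true_eq] at ht
  obtain ⟨-, hab, hac, had, hbc, hbd, hcd⟩ := ht
  let f : Fin 4 → Fin n := fun i => ⟨(i : ℕ), lt_of_lt_of_le i.isLt h⟩
  let g : Fin 4 → Fin n := fun i => match i with | 0 => a | 1 => b | 2 => c | 3 => d
  have hf : Function.Injective f := fun i j hij => Fin.ext (by simpa [f] using congrArg Fin.val hij)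
  have hg : Function.Injective g := by
    intro i j hij
    fin_cases i <;> fin_cases j <;> first | rfl | (exfalso; simp only [g] at hij; simp_all)
  obtain ⟨σ, hσ⟩ := Equiv.Perm.exists_extending_pair f g hf hg
  refine ⟨σ, ?_⟩
  have h0 := hσ 0; have h1 := hσ 1; have h2 := hσ 2; have h3 := hσ 3
  simp only [f, g] at h0 h1 h2 h3
  simp only [quadmap, quad₀]
  refine Prod.ext ?_ (Prod.ext ?_ (Prod.ext ?_ ?_))
  · exact h0
  · exact h1
  · exact h2
  · exact h3

end E3GroupSepCert

namespace TerminalEdgeStep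

open Finset MeasureTheory OneCutCert CovTransferCert E3GroupSepCert CubicThreePointStep
open scoped BigOperators
open Literature.Probability.Percolation Literature.Probability.LatticeModels

variable {n : ℕ}

/-- Four pairwise distinct elements force `4 ≤ n`. [folklore] -/
theorem four_le_of_distinct (a b c y : Fin n) (hab : a ≠ b) (hac : a ≠ c) (hay : a ≠ y) (hbc : b ≠ c) (hby : b ≠ y) (hcy : c ≠ y) :
    4 ≤ n := by
  have hcard : ({a, b, c, y} : Finset (Fin n)).card = 4 := by
    rw [Finset.card_insert_of_notMem (by simp [hab, hac, hay]), Finset.card_insert_of_notMem (by simp [hbc, hby]),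
      Finset.card_insert_of_notMem (by simp [hcy]), Finset.card_singleton]
  have := Finset.card_le_univ ({a, b, c, y} : Finset (Fin n))
  rw [hcard, Fintype.card_fin] at this
  exact this

/-- **From the standard quadruple to every distinct quadruple, any `n`.** [this work] -/
theorem qRowHolds_of_quad₀ (h : 4 ≤ n) (i : Fin 4) (hq : ∀ w : Sym2 (Fin n) → unitInterval, QRowHolds i w (quad₀ n h))
    (w : Sym2 (Fin n) → unitInterval) (a b c y : Fin n)
    (hab : a ≠ b) (hac : a ≠ c) (hay : a ≠ y) (hbc : b ≠ c) (hby : b ≠ y) (hcy : c ≠ y) : QRowHolds i w (a, b, c, y) := by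
  obtain ⟨σ, hσ⟩ := cover_quad h _ (mem_distinctQuad hab hac hay hbc hby hcy)
  rw [← hσ]
  exact qRowHolds_forall_relabel i σ hq w

/-! ## The comb step at `n` vertices -/

/-- **COMB STEP at `n`**: the four step rows (L1) = `qTerms 0`, (L2) = `qTerms 1`, (B1) = `qTerms 2` (= `threeB₁`), (B2) = `qTerms 3`
(= `threeB₂`) are comb positive on `K_n` at the standard quadruple `(0,1,2,3)`. [this work] -/
def CombStep (n : ℕ) (h : 4 ≤ n) : Prop := ∀ i : Fin 4, CombPositive (qTerms i (quad₀ n h))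

/-- **Rung `n = 4`** (from `checkStep4`, COMPUTATIONAL ancestry). [this work] -/
theorem combStep_four : CombStep 4 le_rfl := fun i => combPositive_of_checkC 28 _ (checkStep4 i)

/-- **Rung `n = 5`** (from `checkStep5`, COMPUTATIONAL ancestry). [this work] -/
theorem combStep_five : CombStep 5 (by norm_num) := fun i => combPositive_of_checkC 40 _ (checkStep5 i)

/-- **Comb step ⇒ the four rows at every weight vector and every distinct quadruple of `Fin n`.** [this work] -/
theorem qRowHolds_of_combStep (h : 4 ≤ n) (hc : CombStep n h) (i : Fin 4) (w : Sym2 (Fin n) → unitInterval) (a b c y : Fin n)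
    (hab : a ≠ b) (hac : a ≠ c) (hay : a ≠ y) (hbc : b ≠ c) (hby : b ≠ y) (hcy : c ≠ y) : QRowHolds i w (a, b, c, y) :=
  qRowHolds_of_quad₀ h i (fun w' => cval_nonneg_of_combPositive (hc i) w') w a b c y hab hac hay hbc hby hcy

/-- Comb step at `n` gives (L1),(L2) and (B1),(B2) on `Fin n` in the vocabulary of `PolarisedStepUpTo` / `BernsteinStepUpTo`. [this work] -/
theorem polarisedStep_of_combStep (h : 4 ≤ n) (hc : CombStep n h) (w : Sym2 (Fin n) → unitInterval) (a b c y : Fin n)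
    (hab : a ≠ b) (hac : a ≠ c) (hay : a ≠ y) (hbc : b ≠ c) (hby : b ≠ y) (hcy : c ≠ y) :
    (QRowHolds 0 w (a, b, c, y) ∧ QRowHolds 1 w (a, b, c, y)) ∧
    (0 ≤ threeB₁ (lq w a b c) (lu₁ w a b c) (lu₂ w a b c) (lu₃ w a b c) (lt w a b c)
        (lα₁ w a b c y) (lα₂ w a b c y) (lβ₁ w a b c y) (lβ₂ w a b c y) (lβ₃ w a b c y) ∧
      0 ≤ threeB₂ (lq w a b c) (lu₁ w a b c) (lu₂ w a b c) (lu₃ w a b c) (lt w a b c)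
        (lα₁ w a b c y) (lα₂ w a b c y) (lβ₁ w a b c y) (lβ₂ w a b c y) (lβ₃ w a b c y)) := by
  refine ⟨⟨qRowHolds_of_combStep h hc 0 w a b c y hab hac hay hbc hby hcy, qRowHolds_of_combStep h hc 1 w a b c y hab hac hay hbc hby hcy⟩, ?_, ?_⟩
  · have h2 := qRowHolds_of_combStep h hc 2 w a b c y hab hac hay hbc hby hcy
    unfold QRowHolds at h2
    rwa [cval_qTerms_two] at h2
  · have h3 := qRowHolds_of_combStep h hc 3 w a b c y hab hac hay hbc hby hcy
    unfold QRowHolds at h3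
    rwa [cval_qTerms_three] at h3

/-! ## The p-free all-`n` conjecture -/

/-- **COMB STEP CONJECTURE** (p-free form of (L1),(L2),(B1),(B2); census-validated: `n ≤ 5` proved here, `n = 6` certified by two exact engines,
sparse supports `n ≤ 8` sampled; OPEN): the four terminal-edge step rows are comb positive on `K_n` for every `n ≥ 4`. [this work] -/
def CombStepConjecture : Prop := ∀ (n : ℕ) (h : 4 ≤ n), CombStep n h

/-- **The conjecture implies (L1),(L2),(B1),(B2) on every finite weighted graph** (every `N₀`, every weight vector, all distinct marked points). [this work] -/
theorem stepUpTo_of_combStepConjecture (hc : CombStepConjecture) (N₀ : ℕ) : PolarisedStepUpTo N₀ ∧ BernsteinStepUpTo N₀ := by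
  refine ⟨fun n _ w a b c y hab hac hay hbc hby hcy => ?_, fun n _ w a b c y hab hac hay hbc hby hcy => ?_⟩
  · exact (polarisedStep_of_combStep (four_le_of_distinct a b c y hab hac hay hbc hby hcy) (hc n _) w a b c y hab hac hay hbc hby hcy).1
  · exact (polarisedStep_of_combStep (four_le_of_distinct a b c y hab hac hay hbc hby hcy) (hc n _) w a b c y hab hac hay hbc hby hcy).2

/-- In particular the conjecture gives the polarised step for all `N₀` at once. [this work] -/
theorem polarisedStepUpTo_of_combStepConjecture (hc : CombStepConjecture) (N₀ : ℕ) : PolarisedStepUpTo N₀ :=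
  (stepUpTo_of_combStepConjecture hc N₀).1

end TerminalEdgeStep

end Summit.CriticalPhenomena.PercolationContinuityZ3.Theorems
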